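import Mathlib
import HarnessLib

/-!
# Pointwise calculus of the two-level gradient flux
(crux `EmbeddedDrudeMourre.DrudeDissolution`, item stmt-AtomisticToContinuum-12593; `--supports` file for the
toolkit (part 1 of 2; the registered sub-goal `flux_pointwise_bound` is in part 2
`EmbeddedDrudeMourreDrudeDissolutionFluxPointwiseTwo`) of stub B1b″ `stub_excursionSecondDifference` of line
`kinetic-polymer-gas-on-the-time-axis`; closes nothing; lead c13 (process B), 2026-08-17)

WHAT. The `O(δ²)` engine on the period cell (`cell_abs_integral_secondDiff_le`) is fed with the GRADIENT FLUX of
an amplitude `G` along a level function `Ω`: with a frame `e : Fin 3 → V`, `∂ᵢ = fderiv · (e i)`,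
`D = Σᵢ(∂ᵢΩ)²`, `Xᵢ = ∂ᵢΩ/D` (so `ΣXᵢ∂ᵢΩ = 1` where `D ≠ 0`), the level-one flux of `G` is `GXᵢ`, its divergence
`LG = Σᵢ∂ᵢ(GXᵢ)`, and the level-two flux is `(LG)Xᵢ` with divergence `L(LG) = Σᵢ∂ᵢ((LG)Xᵢ)`. The engine's
right-hand side is `δ²∫|L(LG)|`; this file is the POINTWISE bound that turns local size information into a sup
bound: if at a point `p`
`m² ≤ D(p)` (`m > 0`), `|∂ᵢ∂ⱼΩ(p)| ≤ n`, `|∂ₗ∂ᵢ∂ⱼΩ(p)| ≤ t`, `|G(p)| ≤ g₀`, `|∂ᵢG(p)| ≤ g₁`, `|∂ᵢ∂ⱼG(p)| ≤ g₂`,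
then
`|L(LG)(p)| ≤ 9g₂/m² + 189g₁n/m³ + 63g₀t/m³ + 1359g₀n²/m⁴`     (`flux_pointwise_bound`).
(The constants are crude; only the shape `g₂m⁻² + g₁nm⁻³ + g₀(tm⁻³ + n²m⁻⁴)` matters.)

HOW. Coordinate calculus at a point (`fp_mul`, `fp_div`, `fp_sq`), the first and second directional
derivatives of a quotient (`fp_quot_first_bound`, `fp_quot_second_abs_le`), the size of `D`, `∂D`, `∂²D`
(`|∂ᵢΩ| ≤ √D`, `|∂ₗD| ≤ 6n√D`, `|∂ₗ∂ᵢD| ≤ 6n² + 6√D·t`), the level-one formula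
`LF = Σᵢ(∂ᵢF·Xᵢ + F·∂ᵢXᵢ)` valid on the open set `{D ≠ 0}` (so it may be differentiated once more), and
bookkeeping.

WHY (role). In B1b″, `G = W·(1−χ_η)` with `W ≲ S₁²S₂²`, `|∇W| ≲ |S₁S₂|(|S₁|+|S₂|)`, `|∇²W| ≲ S₁²+S₂²`,
cutoff derivatives `η⁻¹, η⁻²` on the shells, `n ≲ |A|+|S₁|+|S₂|`, `m² ≳ A²S₁²+A²S₂²+S₁²S₂² ≳ η⁴` on the support:
every term above is then `≲ η⁻²`, which with the discarded tube mass `η⁴` and `η = δ^{1/3}` gives `δ^{4/3}`.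
-/

noncomputable section

open Set Filter Function Topology
open scoped Topology BigOperators

namespace Summit.AtomisticToContinuum.FouriersLaw.Theorems.DrudeDissolution.KineticPolymerGasOnTheTimeAxis

variable {V : Type*} [NormedAddCommGroup V] [NormedSpace ℝ V]

/-! ### §1 Coordinate calculus at a point -/

/-- Product rule along a direction. [folklore] -/
theorem fp_mul {u w : V → ℝ} {p : V} (hu : DifferentiableAt ℝ u p) (hw : DifferentiableAt ℝ w p) (e : V) :
    fderiv ℝ (fun q => u q * w q) p e = fderiv ℝ u p e * w p + u p * fderiv ℝ w p e := by
  rw [fderiv_fun_mul hu hw]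
  simp only [add_apply, FunLike.coe_smul, Pi.smul_apply, smul_eq_mul]
  ring

/-- Inverse rule along a direction. [folklore] -/
theorem fp_inv {w : V → ℝ} {p : V} (hw : DifferentiableAt ℝ w p) (hp : w p ≠ 0) (e : V) :
    fderiv ℝ (fun q => (w q)⁻¹) p e = -(fderiv ℝ w p e) / (w p) ^ 2 := by
  have h : HasFDerivAt (fun q => (w q)⁻¹)
      ((ContinuousLinearMap.toSpanSingleton ℝ (-(w p ^ 2)⁻¹)).comp (fderiv ℝ w p)) p :=
    (hasFDerivAt_inv hp).comp p hw.hasFDerivAt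
  rw [h.fderiv]
  simp only [ContinuousLinearMap.coe_comp, Function.comp_apply,
    ContinuousLinearMap.toSpanSingleton_apply, smul_eq_mul]
  field_simp

/-- Quotient rule along a direction. [folklore] -/
theorem fp_div {u w : V → ℝ} {p : V} (hu : DifferentiableAt ℝ u p) (hw : DifferentiableAt ℝ w p)
    (hp : w p ≠ 0) (e : V) :
    fderiv ℝ (fun q => u q / w q) p e = (fderiv ℝ u p e * w p - u p * fderiv ℝ w p e) / (w p) ^ 2 := by
  have hfun : (fun q => u q / w q) = fun q => u q * (w q)⁻¹ := funext fun q => div_eq_mul_inv _ _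
  rw [hfun, fp_mul hu (hw.fun_inv hp), fp_inv hw hp]
  field_simp
  ring

/-- Square rule along a direction. [folklore] -/
theorem fp_sq {u : V → ℝ} {p : V} (hu : DifferentiableAt ℝ u p) (e : V) :
    fderiv ℝ (fun q => u q ^ 2) p e = 2 * u p * fderiv ℝ u p e := by
  rw [show (fun q => u q ^ 2) = fun q => u q * u q from funext fun q => sq _, fp_mul hu hu]
  ring

/-- Sum of three squares along a direction. [folklore] -/
theorem fp_sumSq {d : Fin 3 → V → ℝ} {p : V} (hd : ∀ i, DifferentiableAt ℝ (d i) p) (e : V) :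
    fderiv ℝ (fun q => ∑ i, d i q ^ 2) p e = ∑ i, 2 * d i p * fderiv ℝ (d i) p e := by
  have h : (fun q => ∑ i, d i q ^ 2) = fun q => d 0 q ^ 2 + d 1 q ^ 2 + d 2 q ^ 2 :=
    funext fun q => Fin.sum_univ_three _
  rw [h, Fin.sum_univ_three]
  have h0 : DifferentiableAt ℝ (fun q => d 0 q ^ 2) p := (hd 0).pow 2
  have h1 : DifferentiableAt ℝ (fun q => d 1 q ^ 2) p := (hd 1).pow 2
  have h2 : DifferentiableAt ℝ (fun q => d 2 q ^ 2) p := (hd 2).pow 2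
  have h01 : DifferentiableAt ℝ (fun q => d 0 q ^ 2 + d 1 q ^ 2) p := h0.add h1
  rw [fderiv_fun_add h01 h2, fderiv_fun_add h0 h1]
  simp only [add_apply, fp_sq (hd 0), fp_sq (hd 1), fp_sq (hd 2)]

/-! ### §2 Elementary inequalities -/

/-- `|x| ≤ √S` when `x²` is one of three nonnegative squares summing to `S`. [folklore] -/
theorem abs_le_sqrt_of_sq_le {x S : ℝ} (h : x ^ 2 ≤ S) : |x| ≤ Real.sqrt S := by
  rw [← Real.sqrt_sq_eq_abs]
  exact Real.sqrt_le_sqrt h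

/-! ### §3 First and second derivatives of a quotient: bounds at a point -/

/-- **First derivative of a quotient, bound.** If `|u p| ≤ a₀`, `|∂ₑu p| ≤ a₁`, `μ ≤ w p` (`μ > 0`),
`|∂ₑw p| ≤ b₁` then `|∂ₑ(u/w)(p)| ≤ a₁/μ + a₀b₁/μ²`. [folklore] -/
theorem fp_quot_first_bound {u w : V → ℝ} {p : V} (hu : DifferentiableAt ℝ u p) (hw : DifferentiableAt ℝ w p)
    {μ a₀ a₁ b₁ : ℝ} (hμ : 0 < μ) (hμw : μ ≤ w p) (ha₀ : |u p| ≤ a₀) (e : V) (ha₁ : |fderiv ℝ u p e| ≤ a₁)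
    (hb₁ : |fderiv ℝ w p e| ≤ b₁) :
    |fderiv ℝ (fun q => u q / w q) p e| ≤ a₁ / μ + a₀ * b₁ / μ ^ 2 := by
  have hwp : 0 < w p := hμ.trans_le hμw
  rw [fp_div hu hw hwp.ne' e]
  have ha₀' : 0 ≤ a₀ := (abs_nonneg _).trans ha₀
  have hb₁' : 0 ≤ b₁ := (abs_nonneg _).trans hb₁
  rw [abs_div, abs_of_pos (pow_pos hwp 2), div_le_iff₀ (pow_pos hwp 2)]
  calc |fderiv ℝ u p e * w p - u p * fderiv ℝ w p e|
      ≤ |fderiv ℝ u p e * w p| + |u p * fderiv ℝ w p e| := abs_sub _ _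
    _ = |fderiv ℝ u p e| * w p + |u p| * |fderiv ℝ w p e| := by
        rw [abs_mul, abs_mul, abs_of_pos hwp]
    _ ≤ a₁ * w p + a₀ * b₁ := by gcongr
    _ ≤ (a₁ / μ + a₀ * b₁ / μ ^ 2) * w p ^ 2 := by
        have ha₁' : 0 ≤ a₁ := (abs_nonneg _).trans ha₁
        have h1 : a₁ * w p ≤ a₁ / μ * w p ^ 2 := by
          rw [div_mul_eq_mul_div, le_div_iff₀ hμ]
          calc a₁ * w p * μ ≤ a₁ * w p * w p := by gcongr
            _ = a₁ * w p ^ 2 := by ring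
        have h2 : a₀ * b₁ ≤ a₀ * b₁ / μ ^ 2 * w p ^ 2 := by
          rw [div_mul_eq_mul_div, le_div_iff₀ (pow_pos hμ 2)]
          gcongr
        linarith

/-- **Second derivative of a quotient, bound.** For `u, w` of class `C²` near `p` with `μ ≤ w` near `p`
(`μ > 0`; in fact only `μ ≤ w p` at the point is used) and point bounds `|u p| ≤ a₀`, `|∂u p| ≤ a₁` (both directions), `|∂ₑ'∂ₑu p| ≤ a₂`, `|∂w p| ≤ b₁`,
`|∂ₑ'∂ₑw p| ≤ b₂`: `|∂ₑ'∂ₑ(u/w)(p)| ≤ a₂/μ + (4a₁b₁ + a₀b₂)/μ² + 2a₀b₁²/μ³`. [folklore] -/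
theorem fp_quot_second_abs_le {u w : V → ℝ} {p : V} (hu : ContDiffAt ℝ 2 u p) (hw : ContDiffAt ℝ 2 w p)
    {μ a₀ a₁ a₂ b₁ b₂ : ℝ} (hμ : 0 < μ) (hμp : μ ≤ w p) (e e' : V)
    (ha₀ : |u p| ≤ a₀) (ha₁ : |fderiv ℝ u p e| ≤ a₁) (ha₁' : |fderiv ℝ u p e'| ≤ a₁)
    (ha₂ : |fderiv ℝ (fun q => fderiv ℝ u q e) p e'| ≤ a₂)
    (hb₁ : |fderiv ℝ w p e| ≤ b₁) (hb₁' : |fderiv ℝ w p e'| ≤ b₁)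
    (hb₂ : |fderiv ℝ (fun q => fderiv ℝ w q e) p e'| ≤ b₂) :
    |fderiv ℝ (fun q => fderiv ℝ (fun r => u r / w r) q e) p e'| ≤
      a₂ / μ + (4 * a₁ * b₁ + a₀ * b₂) / μ ^ 2 + 2 * a₀ * b₁ ^ 2 / μ ^ 3 := by
  -- differentiability facts near `p`
  have hud : ∀ᶠ q in 𝓝 p, DifferentiableAt ℝ u q :=
    (hu.eventually (by simp)).mono fun q hq => hq.differentiableAt (by simp)
  have hwd : ∀ᶠ q in 𝓝 p, DifferentiableAt ℝ w q :=
    (hw.eventually (by simp)).mono fun q hq => hq.differentiableAt (by simp)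
  have hwp : 0 < w p := hμ.trans_le hμp
  have hw0 : ∀ᶠ q in 𝓝 p, w q ≠ 0 := hw.continuousAt.eventually_ne hwp.ne'
  -- the first derivative is the quotient-rule expression near `p`
  have hfirst : (fun q => fderiv ℝ (fun r => u r / w r) q e) =ᶠ[𝓝 p]
      fun q => (fderiv ℝ u q e * w q - u q * fderiv ℝ w q e) / w q ^ 2 := by
    filter_upwards [hud, hwd, hw0] with q hq hq' hq''
    exact fp_div hq hq' hq'' e
  rw [hfirst.fderiv_eq]
  -- the numerator and denominator are differentiable at `p`
  have hue : DifferentiableAt ℝ (fun q => fderiv ℝ u q e) p :=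
    ((hu.fderiv_right (m := 1) (by norm_num)).differentiableAt one_ne_zero).clm_apply
      (differentiableAt_const e)
  have hwe : DifferentiableAt ℝ (fun q => fderiv ℝ w q e) p :=
    ((hw.fderiv_right (m := 1) (by norm_num)).differentiableAt one_ne_zero).clm_apply
      (differentiableAt_const e)
  have hup : DifferentiableAt ℝ u p := hu.differentiableAt (by simp)
  have hwp' : DifferentiableAt ℝ w p := hw.differentiableAt (by simp)
  have hN : DifferentiableAt ℝ (fun q => fderiv ℝ u q e * w q - u q * fderiv ℝ w q e) p :=
    (hue.mul hwp').sub (hup.mul hwe)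
  have hDen : DifferentiableAt ℝ (fun q => w q ^ 2) p := hwp'.pow 2
  rw [fp_div hN hDen (pow_ne_zero 2 hwp.ne') e']
  -- expand the derivative of the numerator and of the denominator
  have hN' : fderiv ℝ (fun q => fderiv ℝ u q e * w q - u q * fderiv ℝ w q e) p e' =
      (fderiv ℝ (fun q => fderiv ℝ u q e) p e' * w p + fderiv ℝ u p e * fderiv ℝ w p e') -
        (fderiv ℝ u p e' * fderiv ℝ w p e + u p * fderiv ℝ (fun q => fderiv ℝ w q e) p e') := by
    have hA : DifferentiableAt ℝ (fun q => fderiv ℝ u q e * w q) p := hue.mul hwp'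
    have hB : DifferentiableAt ℝ (fun q => u q * fderiv ℝ w q e) p := hup.mul hwe
    rw [fderiv_fun_sub hA hB, sub_apply, fp_mul hue hwp', fp_mul hup hwe]
  have hD' : fderiv ℝ (fun q => w q ^ 2) p e' = 2 * w p * fderiv ℝ w p e' := fp_sq hwp' e'
  rw [hN', hD']
  -- sizes
  have ha₀' : 0 ≤ a₀ := (abs_nonneg _).trans ha₀
  have ha₁p : 0 ≤ a₁ := (abs_nonneg _).trans ha₁
  have hb₁p : 0 ≤ b₁ := (abs_nonneg _).trans hb₁
  have hw2 : 0 < w p ^ 2 := pow_pos hwp 2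
  rw [abs_div, abs_of_pos (pow_pos hw2 2), div_le_iff₀ (pow_pos hw2 2)]
  -- bound the numerator of the big fraction
  have hnum1 : |(fderiv ℝ (fun q => fderiv ℝ u q e) p e' * w p + fderiv ℝ u p e * fderiv ℝ w p e' -
      (fderiv ℝ u p e' * fderiv ℝ w p e + u p * fderiv ℝ (fun q => fderiv ℝ w q e) p e')) * w p ^ 2|
        ≤ (a₂ * w p + a₁ * b₁ + (a₁ * b₁ + a₀ * b₂)) * w p ^ 2 := by
    rw [abs_mul, abs_of_pos hw2]
    refine mul_le_mul_of_nonneg_right ?_ hw2.le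
    refine (abs_sub _ _).trans (add_le_add ((abs_add_le _ _).trans (add_le_add ?_ ?_))
      ((abs_add_le _ _).trans (add_le_add ?_ ?_)))
    · rw [abs_mul, abs_of_pos hwp]; gcongr
    · rw [abs_mul]; exact mul_le_mul ha₁ hb₁' (abs_nonneg _) ha₁p
    · rw [abs_mul]; exact mul_le_mul ha₁' hb₁ (abs_nonneg _) ha₁p
    · rw [abs_mul]; exact mul_le_mul ha₀ hb₂ (abs_nonneg _) ha₀'
  have hnum2 : |(fderiv ℝ u p e * w p - u p * fderiv ℝ w p e) * (2 * w p * fderiv ℝ w p e')| ≤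
      (a₁ * w p + a₀ * b₁) * (2 * w p * b₁) := by
    rw [abs_mul]
    refine mul_le_mul ?_ ?_ (abs_nonneg _) (by positivity)
    · refine (abs_sub _ _).trans (add_le_add ?_ ?_)
      · rw [abs_mul, abs_of_pos hwp]; gcongr
      · rw [abs_mul]; exact mul_le_mul ha₀ hb₁ (abs_nonneg _) ha₀'
    · rw [abs_mul, abs_mul, abs_of_pos hwp, abs_two]; gcongr
  have htot := (abs_sub _ _).trans (add_le_add hnum1 hnum2)
  refine htot.trans ?_
  -- compare with the claimed bound times `(w p ^ 2) ^ 2`, using `μ ≤ w p`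
  have hw1 : 0 < w p := hwp
  have e1 : a₂ * w p * w p ^ 2 ≤ a₂ / μ * (w p ^ 2) ^ 2 := by
    have ha₂ : 0 ≤ a₂ := (abs_nonneg _).trans ha₂
    rw [div_mul_eq_mul_div, le_div_iff₀ hμ]
    calc a₂ * w p * w p ^ 2 * μ ≤ a₂ * w p * w p ^ 2 * w p := by gcongr
      _ = a₂ * (w p ^ 2) ^ 2 := by ring
  have e2 : (a₁ * b₁ + (a₁ * b₁ + a₀ * b₂)) * w p ^ 2 + a₁ * w p * (2 * w p * b₁) ≤
      (4 * a₁ * b₁ + a₀ * b₂) / μ ^ 2 * (w p ^ 2) ^ 2 := by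
    have hb₂ : 0 ≤ b₂ := (abs_nonneg _).trans hb₂
    rw [div_mul_eq_mul_div, le_div_iff₀ (pow_pos hμ 2)]
    have : (a₁ * b₁ + (a₁ * b₁ + a₀ * b₂)) * w p ^ 2 + a₁ * w p * (2 * w p * b₁) =
        (4 * a₁ * b₁ + a₀ * b₂) * w p ^ 2 := by ring
    rw [this]
    calc (4 * a₁ * b₁ + a₀ * b₂) * w p ^ 2 * μ ^ 2 ≤ (4 * a₁ * b₁ + a₀ * b₂) * w p ^ 2 * w p ^ 2 := by
          gcongr
      _ = (4 * a₁ * b₁ + a₀ * b₂) * (w p ^ 2) ^ 2 := by ring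
  have e3 : a₀ * b₁ * (2 * w p * b₁) ≤ 2 * a₀ * b₁ ^ 2 / μ ^ 3 * (w p ^ 2) ^ 2 := by
    rw [div_mul_eq_mul_div, le_div_iff₀ (pow_pos hμ 3)]
    calc a₀ * b₁ * (2 * w p * b₁) * μ ^ 3 ≤ a₀ * b₁ * (2 * w p * b₁) * w p ^ 3 := by gcongr
      _ = 2 * a₀ * b₁ ^ 2 * (w p ^ 2) ^ 2 := by ring
  nlinarith [e1, e2, e3]


/-! ### §4 The gradient square `D = Σᵢ(∂ᵢΩ)²` and its derivatives -/

section Frame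

variable {Ω : V → ℝ} {e : Fin 3 → V} {d : Fin 3 → V → ℝ} {D : V → ℝ}

/-- The frame derivatives `dᵢ = ∂ᵢΩ` are `C²` when `Ω ∈ C³`. [folklore] -/
theorem frame_contDiff_d (hΩ : ContDiff ℝ 3 Ω) (hd : ∀ i q, d i q = fderiv ℝ Ω q (e i)) (i : Fin 3) :
    ContDiff ℝ 2 (d i) := by
  have : d i = fun q => fderiv ℝ Ω q (e i) := funext (hd i)
  rw [this]
  exact (hΩ.fderiv_right (m := 2) (by norm_num)).clm_apply contDiff_const

/-- `D = Σᵢ dᵢ²` is `C²`. [folklore] -/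
theorem frame_contDiff_D (hΩ : ContDiff ℝ 3 Ω) (hd : ∀ i q, d i q = fderiv ℝ Ω q (e i))
    (hD : ∀ q, D q = ∑ i, d i q ^ 2) : ContDiff ℝ 2 D := by
  have : D = fun q => ∑ i, d i q ^ 2 := funext hD
  rw [this]
  exact ContDiff.sum fun i _ => (frame_contDiff_d hΩ hd i).pow 2

omit [NormedAddCommGroup V] [NormedSpace ℝ V] in
/-- `|dᵢ p| ≤ √(D p)`. [folklore] -/
theorem frame_abs_d_le (hD : ∀ q, D q = ∑ i, d i q ^ 2) (p : V) (i : Fin 3) :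
    |d i p| ≤ Real.sqrt (D p) := by
  rw [hD]
  exact abs_le_sqrt_of_sq_le
    (Finset.single_le_sum (f := fun j => d j p ^ 2) (fun j _ => sq_nonneg (d j p)) (Finset.mem_univ i))

omit [NormedAddCommGroup V] [NormedSpace ℝ V] in
/-- `D ≥ 0`. [folklore] -/
theorem frame_D_nonneg (hD : ∀ q, D q = ∑ i, d i q ^ 2) (p : V) : 0 ≤ D p := by
  rw [hD]; exact Finset.sum_nonneg fun i _ => sq_nonneg _

/-- **First derivatives of `D`.** `∂ₗD = Σₖ 2dₖ∂ₗdₖ` everywhere, and `|∂ₗD(p)| ≤ 6n√(D p)` when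
`|∂ₗdₖ(p)| ≤ n`. [folklore] -/
theorem frame_fderiv_D (hΩ : ContDiff ℝ 3 Ω) (hd : ∀ i q, d i q = fderiv ℝ Ω q (e i))
    (hD : ∀ q, D q = ∑ i, d i q ^ 2) (q : V) (v : V) :
    fderiv ℝ D q v = ∑ k, 2 * d k q * fderiv ℝ (d k) q v := by
  have : D = fun q => ∑ i, d i q ^ 2 := funext hD
  rw [this]
  exact fp_sumSq (fun k => ((frame_contDiff_d hΩ hd k).differentiable (by norm_num)) q) v

/-- `|∂ₗD(p)| ≤ 6n√(D p)` when `|∂ₗdₖ(p)| ≤ n`. [folklore] -/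
theorem frame_abs_fderiv_D_le (hΩ : ContDiff ℝ 3 Ω) (hd : ∀ i q, d i q = fderiv ℝ Ω q (e i))
    (hD : ∀ q, D q = ∑ i, d i q ^ 2) (p : V) {n : ℝ} (l : Fin 3)
    (hn : ∀ k, |fderiv ℝ (d k) p (e l)| ≤ n) :
    |fderiv ℝ D p (e l)| ≤ 6 * n * Real.sqrt (D p) := by
  rw [frame_fderiv_D hΩ hd hD p (e l)]
  have hn0 : 0 ≤ n := (abs_nonneg _).trans (hn 0)
  have hterm : ∀ k, |2 * d k p * fderiv ℝ (d k) p (e l)| ≤ 2 * n * Real.sqrt (D p) := by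
    intro k
    rw [abs_mul, abs_mul, abs_two]
    calc 2 * |d k p| * |fderiv ℝ (d k) p (e l)| ≤ 2 * Real.sqrt (D p) * n := by
          gcongr
          exacts [frame_abs_d_le hD p k, hn k]
      _ = 2 * n * Real.sqrt (D p) := by ring
  calc |∑ k, 2 * d k p * fderiv ℝ (d k) p (e l)| ≤ ∑ k, |2 * d k p * fderiv ℝ (d k) p (e l)| :=
        Finset.abs_sum_le_sum_abs _ _
    _ ≤ ∑ _k : Fin 3, 2 * n * Real.sqrt (D p) := Finset.sum_le_sum fun k _ => hterm k
    _ = 6 * n * Real.sqrt (D p) := by rw [Finset.sum_const, Finset.card_univ, Fintype.card_fin]; ring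

/-- **Second derivatives of `D`.** `|∂ₗ'∂ₗD(p)| ≤ 6n² + 6√(D p)·t` when `|∂dₖ(p)| ≤ n` (directions `l,l'`)
and `|∂ₗ'∂ₗdₖ(p)| ≤ t`. [folklore] -/
theorem frame_abs_fderiv2_D_le (hΩ : ContDiff ℝ 3 Ω) (hd : ∀ i q, d i q = fderiv ℝ Ω q (e i))
    (hD : ∀ q, D q = ∑ i, d i q ^ 2) (p : V) {n t : ℝ} (l l' : Fin 3)
    (hn : ∀ k, |fderiv ℝ (d k) p (e l)| ≤ n) (hn' : ∀ k, |fderiv ℝ (d k) p (e l')| ≤ n)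
    (ht : ∀ k, |fderiv ℝ (fun q => fderiv ℝ (d k) q (e l)) p (e l')| ≤ t) :
    |fderiv ℝ (fun q => fderiv ℝ D q (e l)) p (e l')| ≤ 6 * n ^ 2 + 6 * Real.sqrt (D p) * t := by
  have hfun : (fun q => fderiv ℝ D q (e l)) = fun q => ∑ k, 2 * d k q * fderiv ℝ (d k) q (e l) :=
    funext fun q => frame_fderiv_D hΩ hd hD q (e l)
  rw [hfun]
  have hdk : ∀ k, DifferentiableAt ℝ (d k) p := fun k =>
    ((frame_contDiff_d hΩ hd k).differentiable (by norm_num)) p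
  have hdk' : ∀ k, DifferentiableAt ℝ (fun q => fderiv ℝ (d k) q (e l)) p := fun k =>
    ((((frame_contDiff_d hΩ hd k).fderiv_right (m := 1) (by norm_num)).differentiable
      one_ne_zero) p).clm_apply (differentiableAt_const _)
  have h2dk : ∀ k, DifferentiableAt ℝ (fun q => 2 * d k q) p := fun k => (hdk k).const_mul 2
  have hprod : ∀ k, DifferentiableAt ℝ (fun q => 2 * d k q * fderiv ℝ (d k) q (e l)) p := fun k =>
    (h2dk k).mul (hdk' k)
  have hsum : fderiv ℝ (fun q => ∑ k, 2 * d k q * fderiv ℝ (d k) q (e l)) p (e l') =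
      ∑ k, fderiv ℝ (fun q => 2 * d k q * fderiv ℝ (d k) q (e l)) p (e l') := by
    rw [fderiv_fun_sum fun k _ => hprod k, FunLike.coe_sum, Finset.sum_apply]
  rw [hsum]
  have hn0 : 0 ≤ n := (abs_nonneg _).trans (hn 0)
  have hterm : ∀ k, |fderiv ℝ (fun q => 2 * d k q * fderiv ℝ (d k) q (e l)) p (e l')| ≤
      2 * n ^ 2 + 2 * Real.sqrt (D p) * t := by
    intro k
    rw [fp_mul (h2dk k) (hdk' k)]
    have h2 : fderiv ℝ (fun q => 2 * d k q) p (e l') = 2 * fderiv ℝ (d k) p (e l') := by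
      rw [fp_mul (differentiableAt_const _) (hdk k)]
      simp
    rw [h2]
    have hA := hn' k
    have hB := hn k
    have hC := frame_abs_d_le hD p k
    have hE := ht k
    refine (abs_add_le _ _).trans (add_le_add ?_ ?_)
    · rw [abs_mul, abs_mul, abs_two]
      nlinarith [abs_nonneg (fderiv ℝ (d k) p (e l')), abs_nonneg (fderiv ℝ (d k) p (e l))]
    · rw [abs_mul, abs_mul, abs_two]
      nlinarith [abs_nonneg (d k p), abs_nonneg (fderiv ℝ (fun q => fderiv ℝ (d k) q (e l)) p (e l')),
        Real.sqrt_nonneg (D p)]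
  calc |∑ k, fderiv ℝ (fun q => 2 * d k q * fderiv ℝ (d k) q (e l)) p (e l')|
      ≤ ∑ k, |fderiv ℝ (fun q => 2 * d k q * fderiv ℝ (d k) q (e l)) p (e l')| :=
        Finset.abs_sum_le_sum_abs _ _
    _ ≤ ∑ _k : Fin 3, (2 * n ^ 2 + 2 * Real.sqrt (D p) * t) := Finset.sum_le_sum fun k _ => hterm k
    _ = 6 * n ^ 2 + 6 * Real.sqrt (D p) * t := by
        rw [Finset.sum_const, Finset.card_univ, Fintype.card_fin]; ring

/-! ### §5 The vector field `Xᵢ = dᵢ/D` at a point where `D ≥ m² > 0` -/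

variable {X : Fin 3 → V → ℝ}

/-- `Xᵢ` is `C²` at a point where `D ≠ 0`. [folklore] -/
theorem frame_contDiffAt_X (hΩ : ContDiff ℝ 3 Ω) (hd : ∀ i q, d i q = fderiv ℝ Ω q (e i))
    (hD : ∀ q, D q = ∑ i, d i q ^ 2) (hX : ∀ i q, X i q = d i q / D q) {p : V} (hp : D p ≠ 0)
    (i : Fin 3) : ContDiffAt ℝ 2 (X i) p := by
  have : X i = fun q => d i q / D q := funext (hX i)
  rw [this]
  exact (frame_contDiff_d hΩ hd i).contDiffAt.div (frame_contDiff_D hΩ hd hD).contDiffAt hp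

omit [NormedAddCommGroup V] [NormedSpace ℝ V] in
/-- `|Xᵢ(p)| ≤ 1/m` when `m² ≤ D(p)`. [folklore] -/
theorem frame_abs_X_le (hD : ∀ q, D q = ∑ i, d i q ^ 2) (hX : ∀ i q, X i q = d i q / D q)
    {p : V} {m : ℝ} (hm : 0 < m) (hmD : m ^ 2 ≤ D p) (i : Fin 3) : |X i p| ≤ 1 / m := by
  have hDp : 0 < D p := (pow_pos hm 2).trans_le hmD
  have hsq : m ≤ Real.sqrt (D p) := by
    rw [← Real.sqrt_sq hm.le]; exact Real.sqrt_le_sqrt hmD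
  rw [hX, abs_div, abs_of_pos hDp, div_le_div_iff₀ hDp hm]
  calc |d i p| * m ≤ Real.sqrt (D p) * Real.sqrt (D p) := by
        gcongr; exact frame_abs_d_le hD p i
    _ = 1 * D p := by rw [Real.mul_self_sqrt hDp.le, one_mul]

/-- `|∂ₗXᵢ(p)| ≤ 7n/m²` when `m² ≤ D(p)` and `|∂dₖ(p)| ≤ n`. [folklore] -/
theorem frame_abs_fderiv_X_le (hΩ : ContDiff ℝ 3 Ω) (hd : ∀ i q, d i q = fderiv ℝ Ω q (e i))
    (hD : ∀ q, D q = ∑ i, d i q ^ 2) (hX : ∀ i q, X i q = d i q / D q) {p : V} {m n : ℝ}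
    (hm : 0 < m) (hmD : m ^ 2 ≤ D p) (i l : Fin 3) (hn : ∀ k, |fderiv ℝ (d k) p (e l)| ≤ n) :
    |fderiv ℝ (X i) p (e l)| ≤ 7 * n / m ^ 2 := by
  have hDp : 0 < D p := (pow_pos hm 2).trans_le hmD
  have hn0 : 0 ≤ n := (abs_nonneg _).trans (hn 0)
  have : X i = fun q => d i q / D q := funext (hX i)
  rw [this]
  have hdi : DifferentiableAt ℝ (d i) p := ((frame_contDiff_d hΩ hd i).differentiable (by norm_num)) p
  have hDd : DifferentiableAt ℝ D p := ((frame_contDiff_D hΩ hd hD).differentiable (by norm_num)) p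
  have h := fp_quot_first_bound hdi hDd hDp le_rfl (frame_abs_d_le hD p i) (e l) (hn i)
    (frame_abs_fderiv_D_le hΩ hd hD p l hn)
  refine h.trans ?_
  -- `n/D + √D·6n√D/D² = 7n/D ≤ 7n/m²`
  have hsD : Real.sqrt (D p) * Real.sqrt (D p) = D p := Real.mul_self_sqrt hDp.le
  have e1 : n / D p + Real.sqrt (D p) * (6 * n * Real.sqrt (D p)) / D p ^ 2 = 7 * n / D p := by
    field_simp
    nlinarith [hsD]
  rw [e1]
  exact div_le_div_of_nonneg_left (by positivity) (pow_pos hm 2) hmD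


/-- **`|∂ₗXᵢ(p)| ≤ 7n/m²` on `ℝ³` (registered sub-goal `frame_abs_fderiv_X_le_real3` of stub B1b″; all
binders explicit).** [folklore] -/
theorem frame_abs_fderiv_X_le_real3 :
    ∀ (Ω D : ℝ × ℝ × ℝ → ℝ) (e : Fin 3 → ℝ × ℝ × ℝ) (d X : Fin 3 → ℝ × ℝ × ℝ → ℝ) (p : ℝ × ℝ × ℝ)
      (m n : ℝ) (i l : Fin 3), ContDiff ℝ 3 Ω → (∀ i q, d i q = fderiv ℝ Ω q (e i)) →
      (∀ q, D q = ∑ i, d i q ^ 2) → (∀ i q, X i q = d i q / D q) → 0 < m → m ^ 2 ≤ D p →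
      (∀ k, |fderiv ℝ (d k) p (e l)| ≤ n) → |fderiv ℝ (X i) p (e l)| ≤ 7 * n / m ^ 2 :=
  fun _ _ _ _ _ _ _ _ i l hΩ hd hD hX hm hmD hn => frame_abs_fderiv_X_le hΩ hd hD hX hm hmD i l hn

end Frame

end Summit.AtomisticToContinuum.FouriersLaw.Theorems.DrudeDissolution.KineticPolymerGasOnTheTimeAxis

end
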